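import Mathlib
import Summits.ValiantsHypothesis.ValiantsHypothesis.Theorems.BarrierLeverDefinableEquationsSparsityWallTwo
import Summits.ValiantsHypothesis.ValiantsHypothesis.Theorems.BarrierLeverDefinableEquationsRungOneEquation
import Summits.ValiantsHypothesis.ValiantsHypothesis.Theorems.BarrierLeverDefinableEquationsLinearSizeDegree
import HarnessLib

/-!
# Crux `BarrierLever.DefinableEquations` (stmt-8745) / `SingleSizeEquations` (stmt-8749) —
# SUPPORT AND DEGREE WALLS AT THE OPEN RUNG `b = 2`, amortised (val-np-p5 g16)

Companion of `…SparsityWallTwo.lean`.  The same amortised budget (`batchBudget`, `budget_two`: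
`t·n` free monomials of degree `≤ n` inside size `n²`, eventually in `n`) applied WITHOUT a shift —
kill all coordinates outside the support of one monomial of the equation — gives:

* `lt_card_support_monomial_of_batch` (size-parametrised): if `E` vanishes on the degree-`≤ n`,
  size-`≤ s` polynomials and `batchBudget n r k t ≤ s`, every monomial of `E` involves `> t`
  distinct coefficient variables;
* `mul_lt_card_support_monomial_two`, `mul_lt_totalDegree_two`: for every `t`, eventually in `n`,
  for every `b ≥ 2`, every monomial of an equation for `SmallCircuits ℂ n b` involves MORE THAN `t·n`
  of the `N = C(2n,n)` coordinates, and a nonzero equation has degree `> t·n` (tree, val-np-p5 g12: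
  `≥ n` and `≥ n`, `rung_two_le_card_support_monomial` / `rung_two_le_totalDegree`);
* `mul_lt_totalDegree_boolSum_two`: the same for every Boolean-sum witness of the crux at `(n, 2)`;
* `sparse_exponent_threshold`: the size exponent of the sparse row is EXACTLY `2` — at `b ≤ 1` a
  single MONOMIAL (`∏_j c_{x_j^3}`, tree `…RungOneEquation` / `…LinearSizeDegree`) is a natural proof,
  at `b ≥ 2` no `N^a`-sparse polynomial is, for any `a`, eventually in `n`;
* `card_support_boolSum_le` (`#supp (boolSum H) ≤ #supp H`) and `pow_lt_card_support_inner_two`: the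
  inner polynomial `H` of a witness at `(n, 2)` has `> N^a` monomials as well, whatever `q`.

Reading: the minimal degree of an equation at the open rung is SUPER-LINEAR in `n = Θ(log N)`
(non-constructively, equations of degree `n^{1+o(1)}` exist by the dimension count, so this is the
right order up to `n^{o(1)}`).  WHAT THIS IS NOT: no verdict on the crux (`b = 2` OPEN); nothing on
`VP ≠ VNP`.  No definitions, no named facts; standard axioms.  Refs: [ForbesShpilkaVolk2018] Def. 1;
Bürgisser 2000 §2.1.
-/

-- `Summit.ValiantsHypothesis.ValiantsHypothesis.…` repeats a component by the D-0017 layout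
-- (single-conjunct summit), which the `dupNamespace` linter flags; the name is mandated.
set_option linter.dupNamespace false

noncomputable section

namespace Summit.ValiantsHypothesis.ValiantsHypothesis.Theorems.BarrierLeverDefinableEquations

open MvPolynomial
open Literature.Computability.AlgebraicComplexity Literature.Barriers.ValiantsHypothesis
open scoped BigOperators

namespace SparsityWall

/-! ## §5 Support and degree walls at `b = 2`, amortised: every monomial of an equation involves
## more than `t·n` coordinates (the tree had `≥ n`, `rung_two_le_card_support_monomial`) -/

/-- **Monomials of an equation are wide, size-parametrised and amortised.**  If `E` vanishes at
`coeff g` for every `g` of degree `≤ n` and size `≤ s` and `batchBudget n r k t ≤ s` (`r ≥ 1`), then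
every monomial of `E` involves more than `t` distinct coefficient variables (kill the other
coordinates: `Σ_{μ ∈ supp m} w_μ x^μ` is in the class for every `w`). [folklore] -/
theorem lt_card_support_monomial_of_batch {n r k t s : ℕ} (hr : 0 < r)
    (h : batchBudget n r k t ≤ s) {E : MvPolynomial (degLEMonomials n) ℂ}
    (hvan : ∀ g : MvPolynomial (Fin n) ℂ, g.totalDegree ≤ n → complexity g ≤ s →
      eval (coeffVector (degLEMonomials n) g) E = 0)
    {m : (degLEMonomials n) →₀ ℕ} (hm : m ∈ E.support) : t < m.support.card := by
  have hshift : aeval (fun μ : degLEMonomials n =>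
      C (coeff (μ : Fin n →₀ ℕ) (0 : MvPolynomial (Fin n) ℂ)) + X μ) E = E := by
    have : (fun μ : degLEMonomials n =>
        C (coeff (μ : Fin n →₀ ℕ) (0 : MvPolynomial (Fin n) ℂ)) + X μ) = X := by
      funext μ; rw [coeff_zero, C_0, zero_add]
    rw [this, aeval_X_left, AlgHom.id_apply]
  have h0 : 0 + batchBudget n r k t ≤ s := by rwa [zero_add]
  refine card_support_gt_of_shift_batch (f₀ := 0) hr h0 hvan (by rw [totalDegree_zero]; exact n.zero_le)
    (by rw [← C_0, complexity_C_holds]) ?_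
  rwa [hshift]

/-- **Support wall at the open rung.**  For every `t` there is `n₀` such that for all `n ≥ n₀` and
`b ≥ 2`: every monomial of a nonzero... indeed of ANY polynomial `E` vanishing on
`coeff(SmallCircuits ℂ n b)` involves more than `t·n` of the `C(2n,n)` coefficient variables (g12:
`≥ n` at `b = 2`). [folklore] -/
theorem mul_lt_card_support_monomial_two :
    ∀ t : ℕ, ∃ n₀ : ℕ, ∀ n : ℕ, n₀ ≤ n → ∀ b : ℕ, 2 ≤ b →
      ∀ E : MvPolynomial (degLEMonomials n) ℂ,
        (∀ f ∈ SmallCircuits ℂ n b, eval (coeffVector (degLEMonomials n) f) E = 0) →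
          ∀ m ∈ E.support, t * n < m.support.card := by
  intro t
  refine ⟨4 * (2 ^ blockSize t + 2 * t * (3 * levels t + 2) + 3) + blockSize t * 2 ^ blockSize t,
    fun n hn b hb E hvan m hm => ?_⟩
  have hn1 : 1 ≤ n := Nat.succ_le_of_lt (lt_of_lt_of_le (by positivity) hn)
  have hr : 0 < blockSize t := by unfold blockSize; omega
  have hbud : batchBudget n (blockSize t) (levels t) (t * n) ≤ n ^ b :=
    calc batchBudget n (blockSize t) (levels t) (t * n)
        ≤ batchBudget n (blockSize t) (levels t) (2 * t * n) :=
          batchBudget_mono (by rw [mul_assoc]; exact Nat.le_mul_of_pos_left _ (by norm_num))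
      _ ≤ (2 * n + 1) + batchBudget n (blockSize t) (levels t) (2 * t * n) := Nat.le_add_left _ _
      _ ≤ n ^ 2 := budget_two t hn
      _ ≤ n ^ b := Nat.pow_le_pow_right hn1 hb
  exact lt_card_support_monomial_of_batch hr hbud (fun g hg hL => hvan g ⟨hg, hL⟩) hm

/-- **Degree wall at the open rung.**  For every `t`, eventually in `n`, for every `b ≥ 2`: a
NONZERO polynomial in the coefficient variables vanishing on `coeff(SmallCircuits ℂ n b)` has total
degree `> t·n` (g12: `≥ n`). [folklore] -/
theorem mul_lt_totalDegree_two :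
    ∀ t : ℕ, ∃ n₀ : ℕ, ∀ n : ℕ, n₀ ≤ n → ∀ b : ℕ, 2 ≤ b →
      ∀ E : MvPolynomial (degLEMonomials n) ℂ, E ≠ 0 →
        (∀ f ∈ SmallCircuits ℂ n b, eval (coeffVector (degLEMonomials n) f) E = 0) →
          t * n < E.totalDegree := by
  intro t
  obtain ⟨n₀, h⟩ := mul_lt_card_support_monomial_two t
  refine ⟨n₀, fun n hn b hb E hE hvan => ?_⟩
  obtain ⟨m, hm⟩ := Finset.nonempty_iff_ne_empty.mpr (support_eq_empty.not.mpr hE)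
  have hlt := h n hn b hb E hvan m hm
  -- a monomial with more than `t n` variables has degree more than `t n`
  have hdeg : m.support.card ≤ m.degree := by
    rw [Finsupp.degree_apply, Finset.card_eq_sum_ones]
    exact Finset.sum_le_sum fun i hi => Nat.one_le_iff_ne_zero.mpr (Finsupp.mem_support_iff.mp hi)
  calc t * n < m.support.card := hlt
    _ ≤ m.degree := hdeg
    _ ≤ E.totalDegree := by
        rw [Finsupp.degree_apply]; exact le_totalDegree hm

/-- **Crux currency: Boolean-sum witnesses at `(n, 2)` have degree `> t·n` and only monomials with
`> t·n` coordinates**, for every `t`, eventually in `n` — whatever `q`, `L(H)`, `deg H`.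
[cite: ForbesShpilkaVolk2018, Def. 1] -/
theorem mul_lt_totalDegree_boolSum_two :
    ∀ t : ℕ, ∃ n₀ : ℕ, ∀ n : ℕ, n₀ ≤ n → ∀ (q : ℕ)
      (H : MvPolynomial (↥(degLEMonomials n) ⊕ Fin q) ℂ), boolSum H ≠ 0 →
        (∀ f ∈ SmallCircuits ℂ n 2, eval (coeffVector (degLEMonomials n) f) (boolSum H) = 0) →
          t * n < (boolSum H).totalDegree ∧
            ∀ m ∈ (boolSum H).support, t * n < m.support.card := by
  intro t
  obtain ⟨n₁, h₁⟩ := mul_lt_totalDegree_two t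
  obtain ⟨n₂, h₂⟩ := mul_lt_card_support_monomial_two t
  refine ⟨max n₁ n₂, fun n hn q H hne hvan => ⟨?_, ?_⟩⟩
  · exact h₁ n (le_trans (le_max_left _ _) hn) 2 le_rfl _ hne hvan
  · exact h₂ n (le_trans (le_max_right _ _) hn) 2 le_rfl _ hvan

/-! ## §6 The exact exponent of the sparse row: monomial equations at `b ≤ 1`, none sparse at `b ≥ 2` -/

/-- **A one-monomial natural proof at `b ≤ 1`.**  For `n ≥ 3` and `b ≤ 1` the monomial
`∏_j c_{x_j^3}` is an FSV natural proof against `SmallCircuits ℂ n b` from the class of `1`-sparse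
distinguishers: a polynomial of size `≤ n` has a variable of individual degree `≤ 2` (tree
`exists_degreeOf_le_two_of_complexity_le`), so one cube coefficient vanishes. [folklore] -/
theorem exists_monomial_naturalProof_of_le_one {n : ℕ} (hn : 3 ≤ n) {b : ℕ} (hb : b ≤ 1) :
    ∃ D, IsNaturalProof (degLEMonomials n) (SmallCircuits ℂ n b)
      {D : MvPolynomial (degLEMonomials n) ℂ | D.support.card ≤ 1} D := by
  classical
  set cube : Fin n → degLEMonomials n :=
    fun j => ⟨Finsupp.single j 3, single_three_mem_degLEMonomials hn j⟩ with hcube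
  refine ⟨∏ j : Fin n, X (cube j), ?_, ?_, ?_⟩
  · -- one monomial
    have hmono : (∏ j : Fin n, X (cube j) : MvPolynomial (degLEMonomials n) ℂ) =
        monomial (∑ j : Fin n, Finsupp.single (cube j) 1) 1 := by
      rw [monomial_sum_one]; rfl
    show (∏ j : Fin n, X (cube j) : MvPolynomial (degLEMonomials n) ℂ).support.card ≤ 1
    rw [hmono]
    exact (Finset.card_le_card (support_monomial_subset)).trans (Finset.card_singleton _).le
  · exact Finset.prod_ne_zero_iff.mpr fun j _ => X_ne_zero (cube j)
  · intro f hf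
    rw [map_prod]
    have hLf : complexity f ≤ n :=
      hf.2.trans ((Nat.pow_le_pow_right (by omega) hb).trans (pow_one n).le)
    obtain ⟨j, hj⟩ := exists_degreeOf_le_two_of_complexity_le n (by omega) f hLf
    refine Finset.prod_eq_zero (Finset.mem_univ j) ?_
    rw [eval_X, coeffVector_apply]
    exact coeff_single_three_eq_zero hj

/-- **The size exponent of FSV's sparse bullet is exactly `2` (regime `d = n`).**  At every
`b ≤ 1` (`n ≥ 3`) some `1`-sparse polynomial — a single monomial — is a natural proof against
`SmallCircuits ℂ n b`; at every `b ≥ 2` and every sparsity exponent `a`, eventually in `n`, NO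
`C(2n,n)^a`-sparse polynomial is. [cite: ForbesShpilkaVolk2018, Thm. 9 and Cor. 34] -/
theorem sparse_exponent_threshold :
    (∀ n : ℕ, 3 ≤ n → ∀ b : ℕ, b ≤ 1 → ∃ D, IsNaturalProof (degLEMonomials n) (SmallCircuits ℂ n b)
        {D : MvPolynomial (degLEMonomials n) ℂ | D.support.card ≤ 1} D) ∧
      ∀ a : ℕ, ∃ n₀ : ℕ, ∀ n : ℕ, n₀ ≤ n → ∀ b : ℕ, 2 ≤ b →
        ¬ ∃ D, IsNaturalProof (degLEMonomials n) (SmallCircuits ℂ n b)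
          {D : MvPolynomial (degLEMonomials n) ℂ | D.support.card ≤ Nat.choose (2 * n) n ^ a} D :=
  ⟨fun _ hn _ hb => exists_monomial_naturalProof_of_le_one hn hb, no_sparse_naturalProof_two⟩

/-! ## §7 The Boolean sum of a sparse `H` is sparse: no witness with an `N^a`-sparse `H` either -/

section BoolSumSupport

variable {τ : Type*} {q : ℕ}

/-- Substituting variables for the `τ`-variables and constants for the Boolean variables maps the
monomial `c·X^M` to a scalar multiple of the monomial `X^{M|τ}` — whose exponent does not depend on
the constants. [folklore] -/
theorem aeval_boolPoint_monomial (e : Fin q → Bool) (M : (τ ⊕ Fin q) →₀ ℕ) (c : ℂ) :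
    ∃ d : ℂ, aeval (Sum.elim X fun j => if e j then (1 : MvPolynomial τ ℂ) else 0) (monomial M c) =
      monomial (∑ v ∈ M.support, Sum.elim (fun i => Finsupp.single i (M v)) (fun _ => 0) v) d := by
  classical
  -- every factor of the substituted monomial is a monomial with an `e`-independent exponent
  have hfac : ∀ v : τ ⊕ Fin q, ∃ dv : ℂ,
      (Sum.elim X (fun j => if e j then (1 : MvPolynomial τ ℂ) else 0) v) ^ (M v) =
        monomial (Sum.elim (fun i => Finsupp.single i (M v)) (fun _ => 0) v) dv := by
    rintro (i | j)
    · exact ⟨1, by rw [Sum.elim_inl, Sum.elim_inl, X_pow_eq_monomial]⟩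
    · refine ⟨(if e j then 1 else 0) ^ (M (Sum.inr j)), ?_⟩
      rw [Sum.elim_inr, Sum.elim_inr]
      have h01 : (if e j then (1 : MvPolynomial τ ℂ) else 0) = C (if e j then (1 : ℂ) else 0) := by
        split_ifs <;> simp
      rw [h01, ← C_pow, ← monomial_zero']
  choose dv hdv using hfac
  refine ⟨c * ∏ v ∈ M.support, dv v, ?_⟩
  rw [aeval_monomial, Finsupp.prod, Finset.prod_congr rfl fun v _ => hdv v, ← monomial_sum_prod,
    Algebra.algebraMap_eq_smul_one, smul_mul_assoc, one_mul, smul_monomial, smul_eq_mul]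

/-- The Boolean sum of a single monomial has at most one monomial. [folklore] -/
theorem card_support_boolSum_monomial_le (M : (τ ⊕ Fin q) →₀ ℕ) (c : ℂ) :
    (boolSum (monomial M c)).support.card ≤ 1 := by
  classical
  choose d hd using fun e : Fin q → Bool => aeval_boolPoint_monomial e M c
  have hsum : boolSum (monomial M c) =
      monomial (∑ v ∈ M.support, Sum.elim (fun i => Finsupp.single i (M v)) (fun _ => 0) v)
        (∑ e : Fin q → Bool, d e) := by
    rw [boolSum, map_sum]
    exact Finset.sum_congr rfl fun e _ => hd e
  rw [hsum]
  exact (Finset.card_le_card support_monomial_subset).trans (Finset.card_singleton _).le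

/-- **The Boolean sum does not increase the number of monomials**: `#supp (boolSum H) ≤ #supp H`.
[folklore] -/
theorem card_support_boolSum_le (H : MvPolynomial (τ ⊕ Fin q) ℂ) :
    (boolSum H).support.card ≤ H.support.card := by
  classical
  induction H using MvPolynomial.monomial_add_induction_on with
  | C a =>
    rw [← monomial_zero']
    by_cases ha : a = 0
    · subst ha
      simp [boolSum]
    · refine (card_support_boolSum_monomial_le 0 a).trans ?_
      rw [support_monomial, if_neg ha, Finset.card_singleton]
  | monomial_add M b f hM hb ih =>
    have hadd : boolSum (monomial M b + f) = boolSum (monomial M b) + boolSum f := by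
      simp only [boolSum, map_add, Finset.sum_add_distrib]
    have hMf : M ∉ f.support := hM
    -- `supp (monomial M b + f) ⊇ insert M (supp f)`
    have hbig : insert M f.support ⊆ (monomial M b + f).support := by
      intro m hm
      rw [mem_support_iff, coeff_add, coeff_monomial]
      rcases Finset.mem_insert.mp hm with rfl | hm'
      · rw [if_pos rfl, notMem_support_iff.mp hMf, add_zero]; exact hb
      · have hne : M ≠ m := fun h => hMf (h ▸ hm')
        rw [if_neg hne, zero_add]; exact mem_support_iff.mp hm'
    calc (boolSum (monomial M b + f)).support.card
        ≤ ((boolSum (monomial M b)).support ∪ (boolSum f).support).card := by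
          rw [hadd]; exact Finset.card_le_card support_add
      _ ≤ (boolSum (monomial M b)).support.card + (boolSum f).support.card := Finset.card_union_le _ _
      _ ≤ 1 + f.support.card := Nat.add_le_add (card_support_boolSum_monomial_le M b) ih
      _ = (insert M f.support).card := by rw [Finset.card_insert_of_notMem hMf, add_comm]
      _ ≤ (monomial M b + f).support.card := Finset.card_le_card hbig

end BoolSumSupport

/-- **Crux currency: the inner polynomial `H` of a witness at `(n, 2)` is dense too.**  For every
`a`, eventually in `n`: if `boolSum H ≠ 0` vanishes on `coeff(SmallCircuits ℂ n 2)` then `H` itself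
has more than `C(2n,n)^a` monomials (the Boolean sum of an `s`-sparse `H` is `s`-sparse) — no "`ΣΠ`
inside the Boolean sum" datum proves the open rung, whatever `q`. [cite: ForbesShpilkaVolk2018, Def. 1] -/
theorem pow_lt_card_support_inner_two :
    ∀ a : ℕ, ∃ n₀ : ℕ, ∀ n : ℕ, n₀ ≤ n → ∀ (q : ℕ)
      (H : MvPolynomial (↥(degLEMonomials n) ⊕ Fin q) ℂ), boolSum H ≠ 0 →
        (∀ f ∈ SmallCircuits ℂ n 2, eval (coeffVector (degLEMonomials n) f) (boolSum H) = 0) →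
          Nat.choose (2 * n) n ^ a < H.support.card := by
  intro a
  obtain ⟨n₀, h⟩ := pow_lt_card_support_boolSum_two a
  exact ⟨n₀, fun n hn q H hne hvan => (h n hn q H hne hvan).trans_le (card_support_boolSum_le H)⟩

/-! ## §8 Slice closure of the zero set at the open rung (appended by the same seat)

The geometric content of the amortised budget, stated once in full: the common zero set of the
equations of `SmallCircuits ℂ n 2` contains EVERY coordinate slice of dimension `2an` through EVERY
coefficient vector of a degree-`≤ n` polynomial of HALF the size — for every `a`, eventually in `n`. -/

/-- **Half budget.**  With `k = levels a`, `r = blockSize a` and `n ≥ n₀(a)` (the threshold of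
`budget_two`): `n²/2 + batchBudget n r k (2an) ≤ n²` — `2an` amortised free monomials cost at most
`n²/4 + O_a(n) ≤ n²/2`. [folklore] -/
theorem budget_half (a : ℕ) {n : ℕ}
    (hn : 4 * (2 ^ blockSize a + 2 * a * (3 * levels a + 2) + 3) + blockSize a * 2 ^ blockSize a ≤ n) :
    n ^ 2 / 2 + batchBudget n (blockSize a) (levels a) (2 * a * n) ≤ n ^ 2 := by
  set k := levels a with hk
  set r := blockSize a with hr
  set Q := n / 2 ^ k with hQ
  set P := n / r with hP
  have hQn : 2 ^ k * Q ≤ n := by rw [hQ, mul_comm]; exact Nat.div_mul_le_self n (2 ^ k)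
  have hPn : r * P ≤ n := by rw [hP, mul_comm]; exact Nat.div_mul_le_self n r
  have h16a : 16 * a ≤ 2 ^ k := sixteen_mul_le_two_pow_levels a
  have h16ak : 16 * a * k ≤ r := by rw [hr, hk]; unfold blockSize levels; omega
  have hQ' : 16 * a * Q ≤ n := (Nat.mul_le_mul_right Q h16a).trans hQn
  have hP' : 16 * a * k * P ≤ n := (Nat.mul_le_mul_right P h16ak).trans hPn
  have hQ'' : 16 * a * Q * n ≤ n * n := Nat.mul_le_mul_right n hQ'
  have hP'' : 16 * a * k * P * n ≤ n * n := Nat.mul_le_mul_right n hP'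
  have hlin : (4 * (2 ^ r + 2 * a * (3 * k + 2) + 3) + r * 2 ^ r) * n ≤ n * n :=
    Nat.mul_le_mul_right n hn
  have hconst : r * 2 ^ r ≤ n := le_trans (Nat.le_add_left _ _) hn
  have h12 : 12 ≤ n := by
    have h3 : 3 ≤ 2 ^ r + 2 * a * (3 * k + 2) + 3 := Nat.le_add_left 3 _
    have h4 : 12 ≤ 4 * (2 ^ r + 2 * a * (3 * k + 2) + 3) := by
      calc 12 = 4 * 3 := by norm_num
        _ ≤ 4 * (2 ^ r + 2 * a * (3 * k + 2) + 3) := Nat.mul_le_mul_left 4 h3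
    exact le_trans h4 (le_trans (Nat.le_add_right _ _) hn)
  have hnn : 12 * n ≤ n * n := Nat.mul_le_mul_right n h12
  have hPr : P * 2 ^ r * r ≤ n * 2 ^ r := by
    calc P * 2 ^ r * r = r * P * 2 ^ r := by ring
      _ ≤ n * 2 ^ r := Nat.mul_le_mul_right _ hPn
  have hhalf : n ^ 2 / 2 * 2 ≤ n * n := by rw [pow_two]; exact Nat.div_mul_le_self _ _
  unfold batchBudget
  rw [← hQ, ← hP]
  have expand : (P + 1) * 2 ^ r * r + 2 * a * n * (Q + k * (P + 3) + 2) + 1 =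
      1 + P * 2 ^ r * r + r * 2 ^ r + 2 * a * Q * n + 2 * a * k * P * n +
        6 * a * k * n + 4 * a * n := by ring
  have expand2 : (4 * (2 ^ r + 2 * a * (3 * k + 2) + 3) + r * 2 ^ r) * n =
      4 * (n * 2 ^ r) + 4 * (6 * a * k * n) + 4 * (4 * a * n) + 12 * n + r * 2 ^ r * n := by ring
  rw [expand2] at hlin
  rw [expand, pow_two]
  rw [pow_two] at hhalf
  have hA : 8 * (2 * a * Q * n) ≤ n * n := by
    calc 8 * (2 * a * Q * n) = 16 * a * Q * n := by ring
      _ ≤ n * n := hQ''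
  have hB : 8 * (2 * a * k * P * n) ≤ n * n := by
    calc 8 * (2 * a * k * P * n) = 16 * a * k * P * n := by ring
      _ ≤ n * n := hP''
  omega

/-- **Slice closure at the open rung.**  For every `a` there is `n₀` such that for all `n ≥ n₀` and
`b ≥ 2`: a polynomial `E` vanishing on `coeff(SmallCircuits ℂ n b)` vanishes at `coeff f + w` for
EVERY `f` of degree `≤ n` and size `≤ n²/2`, EVERY set `T` of at most `2an` coefficient coordinates
and EVERY `w` supported on `T` — the zero set of the equation ideal contains all `2an`-dimensional
coordinate slices through all half-size points (the tree's one-direction-at-a-time line lemmas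
`line_subset_zeros[_sharp]` afford `≈ n/2` directions). [folklore] -/
theorem vanishes_on_slices_two :
    ∀ a : ℕ, ∃ n₀ : ℕ, ∀ n : ℕ, n₀ ≤ n → ∀ b : ℕ, 2 ≤ b →
      ∀ E : MvPolynomial (degLEMonomials n) ℂ,
        (∀ f ∈ SmallCircuits ℂ n b, eval (coeffVector (degLEMonomials n) f) E = 0) →
          ∀ f : MvPolynomial (Fin n) ℂ, f.totalDegree ≤ n → complexity f ≤ n ^ 2 / 2 →
            ∀ (T : Finset (degLEMonomials n)) (w : degLEMonomials n → ℂ), T.card ≤ 2 * a * n →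
              (∀ μ, μ ∉ T → w μ = 0) →
                eval (fun μ : degLEMonomials n => coeff (μ : Fin n →₀ ℕ) f + w μ) E = 0 := by
  intro a
  refine ⟨4 * (2 ^ blockSize a + 2 * a * (3 * levels a + 2) + 3) + blockSize a * 2 ^ blockSize a,
    fun n hn b hb E hvan f hf hL T w hT hw => ?_⟩
  have hn1 : 1 ≤ n := Nat.succ_le_of_lt (lt_of_lt_of_le (by positivity) hn)
  have hr : 0 < blockSize a := by unfold blockSize; omega
  obtain ⟨hdeg, hsize⟩ := shift_mem_of_batch (k := levels a) hr hf hL T w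
  have hmem : f + ∑ μ ∈ T, monomial (μ : Fin n →₀ ℕ) (w μ) ∈ SmallCircuits ℂ n b := by
    refine ⟨hdeg, hsize.trans ?_⟩
    calc n ^ 2 / 2 + batchBudget n (blockSize a) (levels a) T.card
        ≤ n ^ 2 / 2 + batchBudget n (blockSize a) (levels a) (2 * a * n) :=
          Nat.add_le_add_left (batchBudget_mono hT) _
      _ ≤ n ^ 2 := budget_half a hn
      _ ≤ n ^ b := Nat.pow_le_pow_right hn1 hb
  have h := hvan _ hmem
  rwa [Summit.ValiantsHypothesis.ValiantsHypothesis.Theorems.BarrierLever.SuccinctHittingSetsForVP.ShiftedSupport.coeffVector_shift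
    f T hw] at h

end SparsityWall

end Summit.ValiantsHypothesis.ValiantsHypothesis.Theorems.BarrierLeverDefinableEquations

end
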